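import Summits.Ventures.CertifiedArithmetic.LowPrec.GemmPrecRounding

/-!
# Symbolic round-to-nearest-even in the precision: affine forms in `H = 2^(p-2)` and a free significand

HONEST FRAMING (venture CertifiedArithmetic / cell `pub-lowprec`, seat gemm, gen 12): certified error
envelopes and provably optimal rounding/accumulation schemes for low-precision formats under stated
cost models; every table by two implementations; no hardware or vendor claims.

Infrastructure for paper `gemm.tex` §Regimes, Theorem t:thetap (the terminal constant of FP4 products
for EVERY accumulator precision `p`).  The paper's proof observes that the outcome of one accumulation
step `fl(v + x)` from a vertex `v = (M + t)·2^(j+1)` (quarter units, `M = 2^(p-1)`) by a letter `x` is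
given by finitely many `p`-free rules; implementation A of the cell checks the seven facts of the
θ-certificate on affine forms in the symbol `M`.  This file is the kernel version of that idea, in a
form whose soundness is ONE lemma rather than a rule book: magnitudes are affine forms
`a + b·H + c·T` (`AForm`) in `H = M/2 = 2^(p-2)` and a second symbol `T` (half the trailing significand
of a mid-binade vertex), valid on a parameter domain `Dom` (`H ≥ 128`, i.e. `p ≥ 9`; `36 ≤ T ≤ H - 37`
for the classes that use `T`); `nonnegOn` decides `f ≥ 0` on the whole domain from two vertices and
two recession directions (`nonnegOn_sound`); `tryBinade`/`symRne` perform round-to-nearest-even of a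
symbolic magnitude to `p` significant bits when the binade, the remainder and the parity of the
significand are determined by the form (`symRne_sound`: the result evaluates to `rneSigMag (p-1)` of
the evaluated input, for EVERY parameter in the domain); `ceilHalf` is `⌈t/2⌉` on forms.  The
all-precision θ-certificate of E2M1² (`GemmThetaLawE2M1*.lean`) is a finite computation with these.
-/

namespace Literature.ComputerArithmetic.FloatingPoint

namespace MiniFloat

namespace ThetaLaw

/-! ### Affine forms in `H` and `T` -/

/-- An affine form `a + b·H + c·T` with integer coefficients. [cell, gemm.tex Thm t:thetap proof:
implementation A's affine forms in `M = 2H`] -/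
structure AForm where
  /-- constant coefficient -/
  a : ℤ
  /-- coefficient of `H = 2^(p-2)` -/
  b : ℤ
  /-- coefficient of the free half-significand `T` -/
  c : ℤ
  deriving DecidableEq, Repr

namespace AForm

/-- Value of the form at the parameters `(H, T)`. [cell] -/
def eval (f : AForm) (H T : ℤ) : ℤ := f.a + f.b * H + f.c * T

/-- Sum of forms. [cell] -/
def add (f g : AForm) : AForm := ⟨f.a + g.a, f.b + g.b, f.c + g.c⟩

/-- Difference of forms. [cell] -/
def sub (f g : AForm) : AForm := ⟨f.a - g.a, f.b - g.b, f.c - g.c⟩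

/-- Constant form. [cell] -/
def const (k : ℤ) : AForm := ⟨k, 0, 0⟩

/-- The form `k·H`. [cell] -/
def hH (k : ℤ) : AForm := ⟨0, k, 0⟩

/-- Integer multiple of a form. [cell] -/
def smul (k : ℤ) (f : AForm) : AForm := ⟨k * f.a, k * f.b, k * f.c⟩

/-- Evaluation is additive. [folklore] -/
@[simp] theorem eval_add (f g : AForm) (H T : ℤ) : (f.add g).eval H T = f.eval H T + g.eval H T := by
  unfold add eval; ring

/-- Evaluation respects subtraction. [folklore] -/
@[simp] theorem eval_sub (f g : AForm) (H T : ℤ) : (f.sub g).eval H T = f.eval H T - g.eval H T := by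
  unfold sub eval; ring

/-- Evaluation of a constant form. [folklore] -/
@[simp] theorem eval_const (k H T : ℤ) : (const k).eval H T = k := by
  unfold const eval; ring

/-- Evaluation of a multiple of `H`. [folklore] -/
@[simp] theorem eval_hH (k H T : ℤ) : (hH k).eval H T = k * H := by
  unfold hH eval; ring

/-- Evaluation is homogeneous. [folklore] -/
@[simp] theorem eval_smul (k : ℤ) (f : AForm) (H T : ℤ) : (smul k f).eval H T = k * f.eval H T := by
  unfold smul eval; ring

/-- Evaluation of an explicit form. [folklore] -/
@[simp] theorem eval_mk (a b c H T : ℤ) : (AForm.mk a b c).eval H T = a + b * H + c * T := rfl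

end AForm

open AForm

/-! ### The parameter domain and the decision of `f ≥ 0` on it -/

/-- The parameter domain: `H ≥ 128` (precision `p ≥ 9`); mid-binade classes (`hasT = true`) carry a
half-significand `36 ≤ T ≤ H - 37`, the other classes have `T = 0`. [cell] -/
def Dom (hasT : Bool) (H T : ℤ) : Prop :=
  128 ≤ H ∧ (hasT = true → 36 ≤ T ∧ T ≤ H - 37) ∧ (hasT = false → T = 0)

/-- `f ≥ 0` ON THE WHOLE DOMAIN, decided at two vertices and along two recession directions.
[cell; elementary polyhedral reasoning] -/
def nonnegOn (hasT : Bool) (f : AForm) : Bool :=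
  if hasT then decide (0 ≤ f.eval 128 36) && decide (0 ≤ f.eval 128 91) && decide (0 ≤ f.b) &&
      decide (0 ≤ f.b + f.c)
  else decide (0 ≤ f.eval 128 0) && decide (0 ≤ f.b)

/-- SOUNDNESS of `nonnegOn`: the form is non-negative at every parameter of the domain. [cell] -/
theorem nonnegOn_sound {hasT : Bool} {f : AForm} {H T : ℤ} (h : nonnegOn hasT f = true)
    (hd : Dom hasT H T) : 0 ≤ f.eval H T := by
  obtain ⟨hH, hT1, hT0⟩ := hd
  unfold nonnegOn at h
  cases hasT
  · simp only [Bool.false_eq_true, if_false, Bool.and_eq_true, decide_eq_true_eq] at h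
    obtain ⟨h0, hb⟩ := h
    have hT : T = 0 := hT0 rfl
    subst hT
    unfold AForm.eval at h0 ⊢
    have h1 : 0 ≤ f.b * (H - 128) := mul_nonneg hb (by linarith)
    nlinarith
  · simp only [if_true, Bool.and_eq_true, decide_eq_true_eq] at h
    obtain ⟨⟨⟨h36, h91⟩, hb⟩, hbc⟩ := h
    obtain ⟨hTlo, hThi⟩ := hT1 rfl
    unfold AForm.eval at h36 h91 ⊢
    have h1 : 0 ≤ f.b * (H - 128) := mul_nonneg hb (by linarith)
    have h2 : 0 ≤ (f.b + f.c) * (H - 128) := mul_nonneg hbc (by linarith)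
    by_cases hc : 0 ≤ f.c
    · have h3 : 0 ≤ f.c * (T - 36) := mul_nonneg hc (by linarith)
      nlinarith
    · have h3 : 0 ≤ f.c * (T - (H - 37)) := by nlinarith
      nlinarith

/-! ### Symbolic round-to-nearest-even -/

/-- The target of a symbolic rounding: `big e sig` is the value `sig · 2^e` with `2H ≤ sig ≤ 4H`
(binade `e - 1` of the paper, significand `sig = M + t'`, `t' = M` allowed and meaning the next
binade's first vertex); `small n` is the integer `0 ≤ n < 4H = 2^p` itself (exact). [cell] -/
inductive Tgt where
  | big (e : ℕ) (sig : AForm)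
  | small (n : AForm)
  deriving DecidableEq, Repr

/-- The value form of a target. [cell] -/
def Tgt.val : Tgt → AForm
  | Tgt.big e sig => smul (2 ^ e) sig
  | Tgt.small n => n

/-- ROUND A SYMBOLIC MAGNITUDE `n` IN BINADE `e - 1` (spacing `2^e`): succeeds when the `H`- and
`T`-parts of `n` are multiples of `2^e` with an even `T`-quotient (so that the remainder `n mod 2^e`
and the parity of the significand `⌊n/2^e⌋` are those of the constant coefficient; `H` is even) and
`2H·2^e ≤ n < 4H·2^e` holds on the whole domain; the significand is then rounded half-to-even.
[cell, gemm.tex Thm t:thetap proof, rules (R1)–(R4) at once] -/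
def tryBinade (hasT : Bool) (n : AForm) (e : ℕ) : Option Tgt :=
  if n.b % 2 ^ e = 0 ∧ n.c % 2 ^ e = 0 ∧ (n.c / 2 ^ e) % 2 = 0 ∧
      nonnegOn hasT (n.sub (hH (2 * 2 ^ e))) = true ∧
      nonnegOn hasT (((hH (4 * 2 ^ e)).sub n).sub (const 1)) = true then
    some (Tgt.big e
      ((AForm.mk (n.a / 2 ^ e) (n.b / 2 ^ e) (n.c / 2 ^ e)).add
        (const (if 2 * (n.a % 2 ^ e) < 2 ^ e then 0
                else if (2 : ℤ) ^ e < 2 * (n.a % 2 ^ e) then 1 else (n.a / 2 ^ e) % 2))))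
  else none

/-- `symRne hasT hints n`: round the symbolic magnitude `n` to `p` significant bits — the first binade
of `hints` that applies, else exact if `0 ≤ n < 4H = 2^p` on the domain, else give up. [cell] -/
def symRne (hasT : Bool) (hints : List ℕ) (n : AForm) : Option Tgt :=
  match hints.findSome? (tryBinade hasT n) with
  | some t => some t
  | none =>
      if nonnegOn hasT n = true ∧ nonnegOn hasT (((hH 4).sub n).sub (const 1)) = true then
        some (Tgt.small n)
      else none

/-- SOUNDNESS OF `tryBinade`: at every parameter of the domain (`H` even, `2^m = 2H`) the evaluated
target is `rneSigMag m` of the evaluated input, and its significand lies in `[2H, 4H]`.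
[cell; `rneSigMag_of_binade`, `rneShiftNat_of_decomp`] -/
theorem tryBinade_sound {hasT : Bool} {n : AForm} {e : ℕ} {tg : Tgt} {H T : ℤ} {m : ℕ}
    (h : tryBinade hasT n e = some tg) (hd : Dom hasT H T) (hev : 2 ∣ H) (hM : (2 : ℤ) ^ m = 2 * H) :
    ∃ sig, tg = Tgt.big e sig ∧ 2 * H ≤ sig.eval H T ∧ sig.eval H T ≤ 4 * H ∧ 0 ≤ n.eval H T ∧
      ((rneSigMag m (n.eval H T).toNat : ℕ) : ℤ) = sig.eval H T * 2 ^ e := by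
  unfold tryBinade at h
  obtain ⟨hc, h⟩ := Option.ite_none_right_eq_some.mp h
  obtain ⟨hb, hcd, hpar, hlo, hhi⟩ := hc
  simp only [Option.some.injEq] at h
  subst h
  refine ⟨_, rfl, ?_⟩
  have hP : (0 : ℤ) < 2 ^ e := by positivity
  have hlo' := nonnegOn_sound hlo hd
  have hhi' := nonnegOn_sound hhi hd
  simp only [eval_sub, eval_hH, eval_const] at hlo' hhi'
  -- the decomposition `n = Q·2^e + r`
  set P : ℤ := 2 ^ e with hPdef
  set q0 := n.a / P with hq0
  set r := n.a % P with hr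
  have hr0 : 0 ≤ r := Int.emod_nonneg _ (ne_of_gt hP)
  have hrP : r < P := Int.emod_lt_of_pos _ hP
  have ha : n.a = q0 * P + r := by
    have := Int.emod_add_ediv_mul n.a P
    rw [hq0, hr]; linarith
  obtain ⟨b', hb'⟩ : P ∣ n.b := Int.dvd_of_emod_eq_zero hb
  obtain ⟨c', hc'⟩ : P ∣ n.c := Int.dvd_of_emod_eq_zero hcd
  have hbq : n.b / P = b' := by rw [hb', Int.mul_ediv_cancel_left _ (ne_of_gt hP)]
  have hcq : n.c / P = c' := by rw [hc', Int.mul_ediv_cancel_left _ (ne_of_gt hP)]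
  obtain ⟨c'', hc''⟩ : 2 ∣ c' := by rw [← hcq]; exact Int.dvd_of_emod_eq_zero hpar
  obtain ⟨H', hH'⟩ := hev
  set Q := q0 + b' * H + c' * T with hQ
  have hN : n.eval H T = Q * P + r := by
    unfold AForm.eval; rw [ha, hb', hc', hQ]; ring
  have hQlo : 2 * H ≤ Q := by nlinarith
  have hQhi : Q ≤ 4 * H - 1 := by nlinarith
  have hQ0 : 0 ≤ Q := by linarith [hd.1]
  have hQpar : Q % 2 = q0 % 2 := by
    have : Q = q0 + 2 * (b' * H' + c'' * T) := by rw [hQ, hH', hc'']; ring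
    omega
  -- evaluation of the significand form
  have hsig : ((AForm.mk (n.a / P) (n.b / P) (n.c / P)).add
      (const (if 2 * (n.a % P) < P then 0 else if P < 2 * (n.a % P) then 1 else (n.a / P) % 2))).eval H T
      = Q + (if 2 * r < P then 0 else if P < 2 * r then 1 else Q % 2) := by
    simp only [eval_add, eval_mk, eval_const, hbq, hcq, ← hq0, ← hr, hQpar]
    rw [hQ]
  rw [hsig]
  have hρ0 : (0 : ℤ) ≤ (if 2 * r < P then 0 else if P < 2 * r then 1 else Q % 2) := by
    split_ifs <;> omega
  have hρ1 : (if 2 * r < P then 0 else if P < 2 * r then 1 else Q % 2) ≤ (1 : ℤ) := by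
    split_ifs <;> omega
  have hN0 : 0 ≤ n.eval H T := by rw [hN]; nlinarith
  refine ⟨by linarith, by linarith, hN0, ?_⟩
  -- the natural-number rounding
  have hQcast : ((Q.toNat : ℕ) : ℤ) = Q := Int.toNat_of_nonneg hQ0
  have hrcast : ((r.toNat : ℕ) : ℤ) = r := Int.toNat_of_nonneg hr0
  have hNcast : (((n.eval H T).toNat : ℕ) : ℤ) = n.eval H T := Int.toNat_of_nonneg hN0
  have hNnat : (n.eval H T).toNat = Q.toNat * 2 ^ e + r.toNat := by
    have h1 : (((n.eval H T).toNat : ℕ) : ℤ) = ((Q.toNat * 2 ^ e + r.toNat : ℕ) : ℤ) := by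
      push_cast; rw [hNcast, hQcast, hrcast, hN]
    exact_mod_cast h1
  have hrnat : r.toNat < 2 ^ e := by
    have : ((r.toNat : ℕ) : ℤ) < ((2 ^ e : ℕ) : ℤ) := by push_cast; rw [hrcast]; exact hrP
    exact_mod_cast this
  have h2m : (2 : ℤ) ^ (m + e) = 2 * H * P := by rw [pow_add, hM]
  have hloN : 2 ^ (m + e) ≤ (n.eval H T).toNat := by
    have : ((2 ^ (m + e) : ℕ) : ℤ) ≤ (((n.eval H T).toNat : ℕ) : ℤ) := by
      push_cast; rw [hNcast, h2m, hN]; nlinarith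
    exact_mod_cast this
  have hhiN : (n.eval H T).toNat < 2 ^ (m + e + 1) := by
    have : (((n.eval H T).toNat : ℕ) : ℤ) < ((2 ^ (m + e + 1) : ℕ) : ℤ) := by
      push_cast; rw [hNcast, pow_succ, h2m, hN]; nlinarith
    exact_mod_cast this
  rw [rneSigMag_of_binade hloN hhiN, hNnat, rneShiftNat_of_decomp _ hrnat]
  have hc1 : (2 * r.toNat < 2 ^ e) ↔ (2 * r < P) := by
    rw [← Nat.cast_lt (α := ℤ)]; push_cast; rw [hrcast]
  have hc2 : (2 ^ e < 2 * r.toNat) ↔ (P < 2 * r) := by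
    rw [← Nat.cast_lt (α := ℤ)]; push_cast; rw [hrcast]
  by_cases h1 : 2 * r < P
  · rw [if_pos (hc1.mpr h1), if_pos h1]; push_cast; rw [hQcast]; try ring
  · rw [if_neg (mt hc1.mp h1), if_neg h1]
    by_cases h2 : P < 2 * r
    · rw [if_pos (hc2.mpr h2), if_pos h2]; push_cast; rw [hQcast]; try ring
    · rw [if_neg (mt hc2.mp h2), if_neg h2]; push_cast; rw [hQcast]; try ring

/-- SOUNDNESS OF `symRne`, binade case and exact case together: writing `W` for the evaluated
target value, `W = rneSigMag m (n)` at every parameter of the domain. [cell] -/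
theorem symRne_sound {hasT : Bool} {hints : List ℕ} {n : AForm} {tg : Tgt} {H T : ℤ} {m : ℕ}
    (h : symRne hasT hints n = some tg) (hd : Dom hasT H T) (hev : 2 ∣ H) (hM : (2 : ℤ) ^ m = 2 * H) :
    0 ≤ n.eval H T ∧ ((rneSigMag m (n.eval H T).toNat : ℕ) : ℤ) = tg.val.eval H T ∧
      (∀ e sig, tg = Tgt.big e sig → 2 * H ≤ sig.eval H T ∧ sig.eval H T ≤ 4 * H) ∧
      (∀ n', tg = Tgt.small n' → n' = n ∧ n.eval H T < 4 * H) := by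
  unfold symRne at h
  split at h
  · rename_i t ht
    simp only [Option.some.injEq] at h
    subst h
    obtain ⟨e, -, he⟩ := List.exists_of_findSome?_eq_some ht
    obtain ⟨sig, rfl, h1, h2, h3, h4⟩ := tryBinade_sound he hd hev hM
    refine ⟨h3, ?_, ?_, ?_⟩
    · rw [h4]; simp [Tgt.val, mul_comm]
    · rintro e' sig' heq; cases heq; exact ⟨h1, h2⟩
    · rintro n' heq; cases heq
  · obtain ⟨⟨h0, h4⟩, h⟩ := Option.ite_none_right_eq_some.mp h
    simp only [Option.some.injEq] at h
    subst h
    have h0' := nonnegOn_sound h0 hd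
    have h4' := nonnegOn_sound h4 hd
    simp only [eval_sub, eval_hH, eval_const] at h4'
    refine ⟨h0', ?_, ?_, ?_⟩
    · simp only [Tgt.val]
      have hlt : (n.eval H T).toNat < 2 ^ (m + 1) := by
        have : ((n.eval H T).toNat : ℤ) < ((2 ^ (m + 1) : ℕ) : ℤ) := by
          rw [Int.toNat_of_nonneg h0']; push_cast; rw [pow_succ, hM]; linarith
        exact_mod_cast this
      unfold rneSigMag; rw [if_pos hlt, Int.toNat_of_nonneg h0']
    · rintro e sig heq; cases heq
    · rintro n' heq; cases heq; exact ⟨rfl, by linarith⟩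

/-! ### `⌈t/2⌉` on forms -/

/-- `⌈f/2⌉` as a form, when the `H`- and `T`-coefficients are even. [cell] -/
def ceilHalf (f : AForm) : Option AForm :=
  if f.b % 2 = 0 ∧ f.c % 2 = 0 then some ⟨-((-f.a) / 2), f.b / 2, f.c / 2⟩ else none

/-- SOUNDNESS of `ceilHalf`: it evaluates to `⌈t/2⌉ = ⌊(t+1)/2⌋` of the evaluated form. [cell] -/
theorem ceilHalf_sound {f g : AForm} (h : ceilHalf f = some g) (H T : ℤ) :
    g.eval H T = (f.eval H T + 1) / 2 := by
  unfold ceilHalf at h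
  split_ifs at h with hc
  obtain ⟨hb, hcc⟩ := hc
  simp only [Option.some.injEq] at h
  subst h
  obtain ⟨b', hb'⟩ : (2 : ℤ) ∣ f.b := Int.dvd_of_emod_eq_zero hb
  obtain ⟨c', hc'⟩ : (2 : ℤ) ∣ f.c := Int.dvd_of_emod_eq_zero hcc
  have h1 : f.b / 2 = b' := by rw [hb']; simp
  have h2 : f.c / 2 = c' := by rw [hc']; simp
  simp only [eval_mk, h1, h2]
  unfold AForm.eval
  rw [hb', hc']
  set X := b' * H + c' * T with hX
  have e1 : -(-f.a / 2) + b' * H + c' * T = -(-f.a / 2) + X := by rw [hX]; ring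
  have e2 : f.a + 2 * b' * H + 2 * c' * T + 1 = (f.a + 1) + 2 * X := by rw [hX]; ring
  rw [e1, e2]
  omega

/-- Sanity: rounding `(2H + 2T + 1)·4 + 2` (an odd vertex of binade `1` plus the letter `2`, a tie)
gives the even significand `2H + 2T + 2`; `(4H - 3)·2 + 9` carries into binade `1` with significand
`2H + 2` (`(8H + 3)/4` rounded half-even... exactly `2H + 0.75 ↦ 2H + 1`); and `4H - 7 + 3 < 4H` is
exact. [cell, kernel-checked] -/
theorem symRne_values :
    symRne true [2, 1, 3] ⟨6, 8, 8⟩ = some (Tgt.big 2 ⟨2, 2, 2⟩) ∧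
    symRne false [1, 0, 2] ⟨3, 8, 0⟩ = some (Tgt.big 2 ⟨1, 2, 0⟩) ∧
    symRne false [1] ⟨-4, 4, 0⟩ = some (Tgt.small ⟨-4, 4, 0⟩) := by
  decide

end ThetaLaw

end MiniFloat

end Literature.ComputerArithmetic.FloatingPoint
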